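import Literature.Combinatorics.Optimization.LovaszSchrijverMatchingRank
import HarnessLib

/-!
# Stable set polytopes with linear Lovász–Schrijver `N₊`-rank (Au–Tunçel 2024)

Y. H. Au, L. Tunçel, *Stable set polytopes with high lift-and-project ranks for the
Lovász–Schrijver SDP operator*, Math. Program. **212** (2024) 79–114 = arXiv:2303.08971
[AuTuncel2024] (held: `paper:arxiv-2303.08971`, §1–§2 read). The 2024 successor of Stephen–Tunçel
1999 (`LovaszSchrijverMatchingRank.lean`): "Prior to this manuscript, the worst (in terms of
performance by `LS₊`) family of graphs was given by the line graphs of odd cliques … giving a family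
of graphs `G` with `r₊(G) = Θ(√|V(G)|)`. This lower bound … has not been improved since 1999. In
this manuscript, we present what we believe is the first known family of graphs whose `LS₊`-rank
is asymptotically a linear function of the number of vertices" (§1).

* **Definition 1** (§1.1): "Given an integer `k ≥ 2`, define `H_k` to be the graph where
  `V(H_k) := {i_p : i ∈ [k], p ∈ {0,1,2}}`, and the edges of `H_k` are `{i₀, i₁}` and `{i₁, i₂}`
  for every `i ∈ [k]`; `{i₀, j₂}` for all `i, j ∈ [k]` where `i ≠ j`." — `auTuncelGraph k` on
  `Fin k × Fin 3`.
* §2.1–2.2: `LS₊(P)` for `P ⊆ [0,1]ⁿ` is defined through `cone(P) = {(λ, λx) : λ ≥ 0, x ∈ P}`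
  by exactly the conditions `Y ⪰ 0`, `Ye₀ = diag(Y)`, `Yeᵢ, Y(e₀ − eᵢ) ∈ cone(P)` of
  `LovaszSchrijver.IsLiftMatrix`/`Nplus`; `FRAC(G) = {x ∈ [0,1]^V : xᵢ + xⱼ ≤ 1 ∀ {i,j} ∈ E}`,
  `STAB(G) = FRAC(G)_I`, and "the `LS₊`-rank of a graph `G` [is] the minimum non-negative integer
  `p` for which `LS₊ᵖ(FRAC(G)) = STAB(G)`". In the tree's CONE FORM (homogenization, as in
  `LovaszSchrijverMatchingRank.lean`): `fracStableCone G = cone(FRAC(G))`,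
  `stableCone G = cone(FRAC(G))_I = cone(STAB(G))`, and `LS₊ᵖ(FRAC(G)) = STAB(G)` iff
  `N₊ᵖ(cone FRAC(G)) = cone STAB(G)` (both sides are the cones over their slices at `x₀ = 1`).
* **Theorem 2** (§1.1, main result; proof §4): "For every `k ≥ 3`, the `LS₊`-rank of the
  fractional stable set polytope of `H_k` is at least `|V(H_k)|/16`." (`|V(H_k)| = 3k`.) — named
  fact `AuTuncel2024_thm2` (cone form: `N₊ᵖ(cone FRAC(H_k)) ≠ cone STAB(H_k)` whenever
  `16p < 3k`). Not proved here (the source's §3–§4 certificate construction).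

Also recorded from §2.2 for context (not vendored): Lipták–Tunçel 2003, `r₊(G) ≤ ⌊|V(G)|/3⌋`
(Theorem 6 there), so Theorem 2 is tight up to the constant. PROVED here: `cone FRAC(G)` is a
pointed cone inside `Q`, hence `cone STAB(G) ⊆ N₊ʳ(cone FRAC(G))` for every `r` (Lemma 3 of the
source, after Lovász–Schrijver), `stableCone_subset_iterate_Nplus`.
-/

noncomputable section

open Matrix Finset

namespace Literature.Combinatorics.Optimization

namespace AuTuncel2024

open LovaszSchrijver

variable {V : Type*} (G : SimpleGraph V)

/-- **`cone(FRAC(G))`**: `{y ≥ 0 : y_v ≤ y₀ (v ∈ V), y_u + y_v ≤ y₀ ({u,v} ∈ E)}`, the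
homogenization of `FRAC(G) = {x ∈ [0,1]^V : xᵢ + xⱼ ≤ 1 ∀ {i,j} ∈ E(G)}`.
[cite: AuTuncel2024, §2.1 (`cone(P)`) and §2.2 (`FRAC(G)`)] -/
def fracStableCone : Set (Option V → ℝ) :=
  {y | (∀ i, 0 ≤ y i) ∧ (∀ v : V, y (some v) ≤ y none) ∧
    ∀ u v : V, G.Adj u v → y (some u) + y (some v) ≤ y none}

/-- **`cone(STAB(G))`** = the cone generated by the 0-1 vectors of `cone(FRAC(G))`
(`STAB(G) := FRAC(G)_I = conv(FRAC(G) ∩ {0,1}^V)`). [cite: AuTuncel2024, §2.2] -/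
def stableCone : Set (Option V → ℝ) :=
  integralCone (fracStableCone G)

/-- `cone(FRAC(G))` bundled as a pointed cone. [cite: AuTuncel2024, §2.1] -/
def fracStablePointedCone : PointedCone ℝ (Option V → ℝ) where
  carrier := fracStableCone G
  zero_mem' := ⟨fun _ => le_rfl, fun _ => le_rfl, fun _ _ _ => by simp⟩
  add_mem' := by
    rintro x y ⟨hx0, hx1, hx2⟩ ⟨hy0, hy1, hy2⟩
    refine ⟨fun i => add_nonneg (hx0 i) (hy0 i), fun v => ?_, fun u v huv => ?_⟩
    · simpa using add_le_add (hx1 v) (hy1 v)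
    · have h := add_le_add (hx2 u v huv) (hy2 u v huv)
      simp only [Pi.add_apply]
      linarith
  smul_mem' := by
    rintro ⟨c, hc⟩ x ⟨hx0, hx1, hx2⟩
    refine ⟨fun i => mul_nonneg hc (hx0 i), fun v => ?_, fun u v huv => ?_⟩
    · exact mul_le_mul_of_nonneg_left (hx1 v) hc
    · have h := mul_le_mul_of_nonneg_left (hx2 u v huv) hc
      change c * x (some u) + c * x (some v) ≤ c * x none
      linarith [mul_add c (x (some u)) (x (some v))]

/-- `cone(FRAC(G)) ⊆ Q` (the box constraints `0 ≤ y_v ≤ y₀`). [cite: AuTuncel2024, §2.1–2.2] -/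
theorem fracStableCone_subset_coneQ : fracStableCone G ⊆ coneQ V :=
  fun _ hy v => ⟨hy.1 (some v), hy.2.1 v⟩

/-- **`cone STAB(G) ⊆ N₊ʳ(cone FRAC(G))` for every `r`** (Lemma 3 of the source, iterated:
`P ⊇ LS₊(P) ⊇ P_I`). [cite: AuTuncel2024, Lemma 3 (§2.1)] -/
theorem stableCone_subset_iterate_Nplus [Fintype V] (r : ℕ) :
    stableCone G ⊆ Nplus^[r] (fracStableCone G) :=
  integralCone_subset_iterate_Nplus (fracStablePointedCone G) (fracStableCone_subset_coneQ G) r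

/-- **Definition 1: the graphs `H_k`** on `V(H_k) = [k] × {0,1,2}` (vertex `iₚ` = `(i, p)`):
edges `{i₀, i₁}`, `{i₁, i₂}` (`i ∈ [k]`) and `{i₀, j₂}` (`i ≠ j`) — "a complete bipartite graph
[with] a perfect matching [whose edges are] subdivided". [cite: AuTuncel2024, Def. 1 (§1.1)] -/
def auTuncelGraph (k : ℕ) : SimpleGraph (Fin k × Fin 3) :=
  SimpleGraph.fromRel fun a b =>
    (a.1 = b.1 ∧ a.2 = 0 ∧ b.2 = 1) ∨ (a.1 = b.1 ∧ a.2 = 1 ∧ b.2 = 2) ∨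
      (a.1 ≠ b.1 ∧ a.2 = 0 ∧ b.2 = 2)

/-- The adjacency of `H_k`, unfolded. [cite: AuTuncel2024, Def. 1 (§1.1)] -/
theorem auTuncelGraph_adj (k : ℕ) (a b : Fin k × Fin 3) :
    (auTuncelGraph k).Adj a b ↔ a ≠ b ∧
      (((a.1 = b.1 ∧ a.2 = 0 ∧ b.2 = 1) ∨ (a.1 = b.1 ∧ a.2 = 1 ∧ b.2 = 2) ∨
          (a.1 ≠ b.1 ∧ a.2 = 0 ∧ b.2 = 2)) ∨
        ((b.1 = a.1 ∧ b.2 = 0 ∧ a.2 = 1) ∨ (b.1 = a.1 ∧ b.2 = 1 ∧ a.2 = 2) ∨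
          (b.1 ≠ a.1 ∧ b.2 = 0 ∧ a.2 = 2))) := by
  simp [auTuncelGraph, SimpleGraph.fromRel_adj]

/-- **Theorem 2 (Au–Tunçel 2024; named fact, cone form): the `LS₊`-rank of `FRAC(H_k)` is at
least `|V(H_k)|/16 = 3k/16` for every `k ≥ 3`** — i.e. `LS₊ᵖ(FRAC(H_k)) ≠ STAB(H_k)`, in cone
form `N₊ᵖ(cone FRAC(H_k)) ≠ cone STAB(H_k)`, for every `p < 3k/16`. "For every `k ≥ 3`, the
`LS₊`-rank of the fractional stable set polytope of `H_k` is at least `|V(H_k)|/16`." Not proved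
here (§3–§4 of the source). [cite: AuTuncel2024, Thm. 2 (§1.1; proof §4)] -/
def AuTuncel2024_thm2 : Prop :=
  ∀ k : ℕ, 3 ≤ k → ∀ p : ℕ, 16 * p < 3 * k →
    Nplus^[p] (fracStableCone (auTuncelGraph k)) ≠ stableCone (auTuncelGraph k)

/-- Consequence read in the source (§2.2, after Theorem 6: Theorem 2 "rules out the possibility
of a sublinear upper bound on the `LS₊`-rank of a general graph"): for every `p` there is a graph
(`H_k` with `k = 6p + 3`) whose cone `FRAC` is not brought to cone `STAB` by `p` rounds of `N₊`.
[cite: AuTuncel2024, Thm. 2 (§1.1) and §2.2 (after Thm. 6)] -/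
theorem AuTuncel2024_thm2.exists_graph (h : AuTuncel2024_thm2) (p : ℕ) :
    ∃ k : ℕ, Nplus^[p] (fracStableCone (auTuncelGraph k)) ≠ stableCone (auTuncelGraph k) :=
  ⟨6 * p + 3, h (6 * p + 3) (by omega) p (by omega)⟩

end AuTuncel2024

end Literature.Combinatorics.Optimization
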